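import Summits.AtomisticToContinuum.Crystallization.Theorems.FrustratedLawDichotomyStrainedPatchHomSplit

/-!
# The homogeneous-floor half `(H) HomFloor m` of the 27623 strained-patch piece REDUCED TO A LATTICE-SUM INEQUALITY
# (decomp-a2c, prover hand 2, generation 20 — structural lane of stub 2; CERT-DESIGN-g44 §0 «reduction to a lattice-sum inequality, exact, no loss»)

`…StrainedPatchHomSplit.HomFloor m` (lens-5 g43, p842337) quantifies over CLUSTERS: every admissible `(M, z, c)` whose point set is the `133/10`-ball of an
affinely deformed fcc lattice / hcp structure (`IsHomBall`) has ball average `ballAvg (9/5) z (xRec M z) c ≥ m`.  The certifier of record (lens-5 g44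
CERT-DESIGN §0–§2) works instead with ONE number per deformation: the lattice site sum

  `X = ½ · Σ_{v ∈ Λ ∖ 0} W₄₅(‖v‖) − e_W`,  `Λ = G·L_fcc` resp. `Λ = G·L_hex ∪ (G·L_hex + G(hcpShift + ξ))`, `W₄₅ = effPot w₄₅ ω₄ (3/400)`, `e_W = −0.7175 + 3/400`,

and its §0 asserts in prose that this reduction is exact.  This DEF-FREE module PROVES it:

* §1 LOCAL HOMOGENEITY (the general lemma): if around the site `z j` the cluster's point set coincides, within radius `R`, with `z j + T` for a
  displacement set `T`, then every site sum `Σ_k g(z k − z j)` of a kernel `g` vanishing from `‖v‖ ≥ R` on equals the set sum `∑ᶠ v ∈ T, g v`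
  (`sum_eq_finsum_mem_of_locHom`); instances: the pair sum minus the self term (`pairSum_sub_self_eq_finsum`) and the ball cardinality (`card_ball_eq_finsum`);
* §2 members of an admissible cluster carry no levy (`xRec_eq_of_member`), and the SENDER-normalised ball average of a site functional that is constant on the
  members with constant member-ball cardinality is that constant (`ballAvg_eq_of_const`);
* §3 the displacement sets of the two homogeneous families: every member of an fcc ball sees `T = G·L_fcc` (`locHom_fcc`); an A-site of an hcp ball sees
  `T_A = G·L_hex ∪ (G·L_hex + u)`, a B-site sees `T_B = G·L_hex ∪ (G·L_hex − u) = −T_A` (`locHom_hcpA/B`, `finsum_hcpB_eq_hcpA` for even kernels);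
* §4 ★ the EXACT VALUES `ballAvg (9/5) z (xRec M z) c = X_fcc(G)` / `= X_hcp(G, ξ)` on admissible homogeneous balls (`ballAvg_xRec_eq_latticeSum_fcc/hcp`);
* §5 ★★ the REDUCTION `homFloor_iff_latticeSums`: `HomFloor m ⟺` [for every `‖G − 1‖ ≤ 1/4` REALISED by an admissible fcc ball, `m ≤ X_fcc(G)`] ∧ [for every
  `(G, ξ)`, `‖G − 1‖ ≤ 1/4`, `‖ξ‖ ≤ 1/4`, realised by an admissible hcp ball, `m ≤ X_hcp(G, ξ)`]; and the realisability-free sufficient form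
  `homFloor_of_latticeSums` (what an interval branch-and-bound over `(G, ξ)` certifies directly; the certifier's prunes GoodFit / ForceOut are exactly
  «not realisable by an ADMISSIBLE ball»).

No new definitions (the lattice sums are written as `finsum`s over the displacement sets, in the vocabulary of `IsHomBall`); 0 sorry;
axioms ⊆ {propext, Classical.choice, Quot.sound}.  `--supports stmt-AtomisticToContinuum-27623`.
-/

noncomputable section

namespace Summit.AtomisticToContinuum.Crystallization.Theorems.FrustratedLawDichotomyStrainedPatchHomLattice

open scoped BigOperators Classical
open Summit.AtomisticToContinuum.Crystallization.Theorems.FrustratedLawDichotomyRangeCut (Sep)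
open Summit.AtomisticToContinuum.Crystallization.Theorems.FrustratedLawDichotomySchurCut (effPot w₄₅ ω₄ effPot_fourHalf_eq_zero)
open Summit.AtomisticToContinuum.Crystallization.Theorems.FrustratedLawDichotomyMotifLemmas (GoodAtScale)
open Summit.AtomisticToContinuum.Crystallization.Theorems.FrustratedLawDichotomyRuleToolkitGood (goodFlag)
open Summit.AtomisticToContinuum.Crystallization.Theorems.FrustratedLawDichotomyAveragingCut (ball ballAvg mem_ball self_mem_ball card_ball_pos)
open Summit.AtomisticToContinuum.Crystallization.Theorems.FrustratedLawDichotomyAveragingRuleCap (pairSumFeature surplusCap)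
open Summit.AtomisticToContinuum.Crystallization.Theorems.FrustratedLawDichotomyAveragingRuleTightFree (BadNearCap)
open Summit.AtomisticToContinuum.Crystallization.Theorems.FrustratedLawDichotomyStrainedPatchHomSplit
open Literature.Barriers.AtomisticToContinuum.FlatleyTheil2015 (fccVec)

open Summit.AtomisticToContinuum.Crystallization.Theorems.ChargedEnergyGapNegative (E3)

/-! ## §1. Local homogeneity: site sums are displacement-set sums -/

/-- Re-indexing a site sum of an injective cluster as a `finsum` over the displacement image of its point set. [folklore] -/
theorem sum_eq_finsum_mem_image {M : ℕ} {z : Fin M → E3} (hz : Function.Injective z) (j : Fin M) (g : E3 → ℝ) :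
    ∑ k : Fin M, g (z k - z j) = ∑ᶠ v ∈ (fun x : E3 => x - z j) '' Set.range z, g v := by
  rw [finsum_mem_image fun a _ b _ h => sub_left_injective h, finsum_mem_range hz, finsum_eq_sum_of_fintype]

/-- ★ **LOCAL HOMOGENEITY ⟹ site sums are displacement-set sums.**  If, within distance `R` of the site `z j`, the cluster's point set is
`z j + T`, then for every kernel `g` vanishing from `‖v‖ ≥ R` on, `Σ_k g(z k − z j) = ∑ᶠ v ∈ T, g v`. [folklore] -/
theorem sum_eq_finsum_mem_of_locHom {M : ℕ} {z : Fin M → E3} (hz : Function.Injective z) {j : Fin M} {T : Set E3} {R : ℝ}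
    (hT : ∀ x : E3, dist x (z j) < R → (x ∈ Set.range z ↔ x - z j ∈ T)) (g : E3 → ℝ) (hg : ∀ v : E3, R ≤ ‖v‖ → g v = 0) :
    ∑ k : Fin M, g (z k - z j) = ∑ᶠ v ∈ T, g v := by
  rw [sum_eq_finsum_mem_image hz j g]
  apply finsum_mem_inter_support_eq'
  intro v hv
  have hvR : ‖v‖ < R := lt_of_not_ge fun h => hv (hg v h)
  have hd : dist (v + z j) (z j) < R := by simpa [dist_eq_norm] using hvR
  constructor
  · rintro ⟨x, hx, rfl⟩
    have hdx : dist x (z j) < R := by simpa using hd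
    exact (hT x hdx).1 hx
  · intro hvT
    refine ⟨v + z j, (hT (v + z j) hd).2 (by simpa using hvT), by simp⟩

/-- The pair sum minus its self term is the site sum of the kernel `v ↦ 𝟙[v ≠ 0]·W ‖v‖` (injective cluster). [folklore] -/
theorem pairSum_sub_self_eq_sum {M : ℕ} {z : Fin M → E3} (hz : Function.Injective z) (W : ℝ → ℝ) (j : Fin M) :
    pairSumFeature W M z j - W 0 = ∑ k : Fin M, (if z k - z j = 0 then 0 else W ‖z k - z j‖) := by
  have hps : pairSumFeature W M z j = ∑ k : Fin M, W ‖z k - z j‖ := by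
    unfold pairSumFeature
    exact Finset.sum_congr rfl fun k _ => by rw [dist_comm, dist_eq_norm]
  have hdiff : ∑ k : Fin M, (W ‖z k - z j‖ - (if z k - z j = 0 then 0 else W ‖z k - z j‖)) = W 0 := by
    rw [Finset.sum_eq_single j]
    · simp
    · intro k _ hkj
      have hne : z k - z j ≠ 0 := fun h => hkj (hz (sub_eq_zero.1 h))
      simp [hne]
    · intro h; exact absurd (Finset.mem_univ j) h
  rw [hps, ← hdiff, ← Finset.sum_sub_distrib]
  exact Finset.sum_congr rfl fun k _ => by ring

/-- ★ **Pair sum through the displacement set**: `Σ_{k ≠ j} W(r_jk) = ∑ᶠ v ∈ T ∖ {0}, W ‖v‖` for `W` vanishing from `R` on. [folklore] -/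
theorem pairSum_sub_self_eq_finsum {M : ℕ} {z : Fin M → E3} (hz : Function.Injective z) {j : Fin M} {T : Set E3} {R : ℝ}
    (hT : ∀ x : E3, dist x (z j) < R → (x ∈ Set.range z ↔ x - z j ∈ T)) {W : ℝ → ℝ} (hW : ∀ r : ℝ, R ≤ r → W r = 0) :
    pairSumFeature W M z j - W 0 = ∑ᶠ v ∈ {v : E3 | v ≠ 0 ∧ v ∈ T}, W ‖v‖ := by
  rw [pairSum_sub_self_eq_sum hz W j,
    sum_eq_finsum_mem_of_locHom hz hT (fun v : E3 => if v = 0 then 0 else W ‖v‖) fun v hv => by simp [hW _ hv]]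
  rw [finsum_mem_def, finsum_mem_def]
  congr 1
  funext v
  by_cases hv0 : v = 0
  · simp [Set.indicator, hv0]
  · by_cases hvT : v ∈ T <;> simp [Set.indicator, hv0, hvT]

/-- ★ **Ball cardinality through the displacement set**: `#B(j, ρ) = ∑ᶠ v ∈ T, 𝟙[‖v‖ ≤ ρ]` for `ρ < R`. [folklore] -/
theorem card_ball_eq_finsum {M : ℕ} {z : Fin M → E3} (hz : Function.Injective z) {j : Fin M} {T : Set E3} {R ρ : ℝ}
    (hT : ∀ x : E3, dist x (z j) < R → (x ∈ Set.range z ↔ x - z j ∈ T)) (hρ : ρ < R) :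
    ((ball ρ z j).card : ℝ) = ∑ᶠ v ∈ T, (if ‖v‖ ≤ ρ then (1 : ℝ) else 0) := by
  have hcard : ((ball ρ z j).card : ℝ) = ∑ k : Fin M, (if ‖z k - z j‖ ≤ ρ then (1 : ℝ) else 0) := by
    unfold ball
    rw [Finset.card_filter]
    push_cast
    exact Finset.sum_congr rfl fun k _ => by rw [dist_eq_norm]
  rw [hcard]
  exact sum_eq_finsum_mem_of_locHom hz hT (fun v : E3 => if ‖v‖ ≤ ρ then (1 : ℝ) else 0) fun v hv => by
    have : ¬‖v‖ ≤ ρ := fun h => by linarith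
    simp [this]

/-! ## §2. Members of an admissible cluster, and constant ball averages -/

/-- A member of the centre's `9/5`-ball of an ADMISSIBLE cluster is `1/8`-good at fit scale `≤ 3/2` (no `1/8`-bad site near the centre). [folklore] -/
theorem goodFlag_eq_one_of_member {M : ℕ} {z : Fin M → E3} {c j : Fin M} (hA : Admissible M z c) (hj : j ∈ ball (9 / 5) z c) :
    goodFlag (1 / 8) (3 / 2) M z j = 1 := by
  have hg : GoodAtScale (1 / 8) (3 / 2) z j := by
    by_contra h
    exact hA.2.2.2.2.2 ⟨j, hj, h⟩
  unfold goodFlag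
  rw [if_pos hg]

/-- ★ **Members carry no levy**: on the centre's `9/5`-ball of an admissible cluster the capped surplus of record is the bare site energy surplus
`x_j = ½(Σ_k W₄₅(r_jk) − W₄₅ 0) − e_W`. [folklore] -/
theorem xRec_eq_of_member {M : ℕ} {z : Fin M → E3} {c j : Fin M} (hA : Admissible M z c) (hj : j ∈ ball (9 / 5) z c) :
    xRec M z j = (pairSumFeature (effPot w₄₅ ω₄ (3 / 400)) M z j - effPot w₄₅ ω₄ (3 / 400) 0) / 2 - (-(7175 / 10000) + 3 / 400) := by
  have h1 := goodFlag_eq_one_of_member hA hj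
  simp only [xRec, surplusCap, h1, sub_self, mul_zero, sub_zero, zero_mul, add_zero]

/-- ★ **A sender-normalised ball average of a functional constant on the members, with constant member-ball cardinality, is that constant.** [folklore] -/
theorem ballAvg_eq_of_const {ρ : ℝ} (hρ : 0 ≤ ρ) {M : ℕ} {z : Fin M → E3} {x : Fin M → ℝ} {c : Fin M} {X : ℝ}
    (hx : ∀ j ∈ ball ρ z c, x j = X) (hcard : ∀ j ∈ ball ρ z c, ((ball ρ z j).card : ℝ) = (ball ρ z c).card) :
    ballAvg ρ z x c = X := by
  have hpos := card_ball_pos hρ z c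
  unfold ballAvg
  rw [Finset.sum_congr rfl fun j hj => by rw [hx j hj, hcard j hj], Finset.sum_const, nsmul_eq_mul]
  field_simp

/-! ## §3. The displacement sets of the two homogeneous families -/

/-- `latPt` is additive in the label. [folklore] -/
theorem latPt_add (G : E3 →L[ℝ] E3) (f : Fin 3 → E3) (a b : Fin 3 → ℤ) : latPt G f (a + b) = latPt G f a + latPt G f b := by
  unfold latPt
  rw [← map_add, ← Finset.sum_add_distrib]
  congr 1
  exact Finset.sum_congr rfl fun i _ => by push_cast [Pi.add_apply]; rw [add_smul]

/-- `latPt` at the difference of labels. [folklore] -/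
theorem latPt_sub (G : E3 →L[ℝ] E3) (f : Fin 3 → E3) (a b : Fin 3 → ℤ) : latPt G f (a - b) = latPt G f a - latPt G f b := by
  have h := latPt_add G f (a - b) b
  rw [sub_add_cancel] at h
  rw [h]
  abel

/-- `latPt` is odd in the label. [folklore] -/
theorem latPt_neg (G : E3 →L[ℝ] E3) (f : Fin 3 → E3) (a : Fin 3 → ℤ) : latPt G f (-a) = -latPt G f a := by
  have h := latPt_sub G f 0 a
  have h0 : latPt G f 0 = 0 := by simp [latPt]
  simpa [h0] using h

/-- Distance bookkeeping: a point within `R` of a member of the centre's `ρ`-ball is within `R + ρ` of the centre. [folklore] -/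
theorem dist_centre_le {M : ℕ} {z : Fin M → E3} {c j : Fin M} {ρ R : ℝ} (hj : j ∈ ball ρ z c) {x : E3} (hx : dist x (z j) < R) :
    dist x (z c) ≤ R + ρ := by
  have := dist_triangle x (z j) (z c)
  have hjc := mem_ball.1 hj
  linarith

/-- ★ **fcc balls are locally homogeneous**: every member `j` (`dist (z j) (z c) ≤ 9/5`) of a `133/10`-ball of `z c + G·L_fcc` sees, within `9/2`,
exactly `z j + G·L_fcc`. [folklore] -/
theorem locHom_fcc {M : ℕ} {z : Fin M → E3} {c j : Fin M} {G : E3 →L[ℝ] E3}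
    (hrange : Set.range z = {x : E3 | dist x (z c) ≤ 133 / 10 ∧ ∃ a : Fin 3 → ℤ, x = z c + latPt G fccVec a}) (hj : j ∈ ball (9 / 5) z c) :
    ∀ x : E3, dist x (z j) < 9 / 2 → (x ∈ Set.range z ↔ x - z j ∈ {v : E3 | ∃ b : Fin 3 → ℤ, v = latPt G fccVec b}) := by
  have hjmem : z j ∈ Set.range z := ⟨j, rfl⟩
  rw [hrange] at hjmem
  obtain ⟨-, aj, haj⟩ := hjmem
  intro x hx
  constructor
  · intro hxmem
    rw [hrange] at hxmem
    obtain ⟨-, a, ha⟩ := hxmem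
    exact ⟨a - aj, by rw [latPt_sub, ha, haj]; abel⟩
  · rintro ⟨b, hb⟩
    rw [hrange]
    refine ⟨by linarith [dist_centre_le hj hx], aj + b, ?_⟩
    rw [latPt_add, ← sub_add_cancel x (z j), hb, haj]
    abel

/-- ★ **hcp balls are locally homogeneous at A-sites**: a member `z j = z c + G·ℓ` of a `133/10`-ball of `z c + (G·L_hex ∪ (G·L_hex + u))`,
`u = G(hcpShift + ξ)`, sees within `9/2` exactly `z j + (G·L_hex ∪ (G·L_hex + u))`. [folklore] -/
theorem locHom_hcpA {M : ℕ} {z : Fin M → E3} {c j : Fin M} {G : E3 →L[ℝ] E3} {ξ : E3}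
    (hrange : Set.range z = {x : E3 | dist x (z c) ≤ 133 / 10 ∧ ∃ a : Fin 3 → ℤ,
      x = z c + latPt G hexFrame a ∨ x = z c + latPt G hexFrame a + G (hcpShift + ξ)})
    (hj : j ∈ ball (9 / 5) z c) {aj : Fin 3 → ℤ} (haj : z j = z c + latPt G hexFrame aj) :
    ∀ x : E3, dist x (z j) < 9 / 2 → (x ∈ Set.range z ↔
      x - z j ∈ {v : E3 | ∃ b : Fin 3 → ℤ, v = latPt G hexFrame b ∨ v = latPt G hexFrame b + G (hcpShift + ξ)}) := by
  intro x hx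
  constructor
  · intro hxmem
    rw [hrange] at hxmem
    obtain ⟨-, a, ha | ha⟩ := hxmem
    · exact ⟨a - aj, Or.inl (by rw [latPt_sub, ha, haj]; abel)⟩
    · exact ⟨a - aj, Or.inr (by rw [latPt_sub, ha, haj]; abel)⟩
  · rintro ⟨b, hb | hb⟩
    · rw [hrange]
      refine ⟨by linarith [dist_centre_le hj hx], aj + b, Or.inl ?_⟩
      rw [latPt_add, ← sub_add_cancel x (z j), hb, haj]
      abel
    · rw [hrange]
      refine ⟨by linarith [dist_centre_le hj hx], aj + b, Or.inr ?_⟩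
      rw [latPt_add, ← sub_add_cancel x (z j), hb, haj]
      abel

/-- ★ **hcp balls are locally homogeneous at B-sites**: a member `z j = z c + G·ℓ + u` sees within `9/2` exactly `z j + (G·L_hex ∪ (G·L_hex − u))`. [folklore] -/
theorem locHom_hcpB {M : ℕ} {z : Fin M → E3} {c j : Fin M} {G : E3 →L[ℝ] E3} {ξ : E3}
    (hrange : Set.range z = {x : E3 | dist x (z c) ≤ 133 / 10 ∧ ∃ a : Fin 3 → ℤ,
      x = z c + latPt G hexFrame a ∨ x = z c + latPt G hexFrame a + G (hcpShift + ξ)})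
    (hj : j ∈ ball (9 / 5) z c) {aj : Fin 3 → ℤ} (haj : z j = z c + latPt G hexFrame aj + G (hcpShift + ξ)) :
    ∀ x : E3, dist x (z j) < 9 / 2 → (x ∈ Set.range z ↔
      x - z j ∈ {v : E3 | ∃ b : Fin 3 → ℤ, v = latPt G hexFrame b ∨ v = latPt G hexFrame b - G (hcpShift + ξ)}) := by
  intro x hx
  constructor
  · intro hxmem
    rw [hrange] at hxmem
    obtain ⟨-, a, ha | ha⟩ := hxmem
    · exact ⟨a - aj, Or.inr (by rw [latPt_sub, ha, haj]; abel)⟩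
    · exact ⟨a - aj, Or.inl (by rw [latPt_sub, ha, haj]; abel)⟩
  · rintro ⟨b, hb | hb⟩
    · rw [hrange]
      refine ⟨by linarith [dist_centre_le hj hx], aj + b, Or.inr ?_⟩
      rw [latPt_add, ← sub_add_cancel x (z j), hb, haj]
      abel
    · rw [hrange]
      refine ⟨by linarith [dist_centre_le hj hx], aj + b, Or.inl ?_⟩
      rw [latPt_add, ← sub_add_cancel x (z j), hb, haj]
      abel

/-- The B-site displacement set is the reflection of the A-site one: `T_B = −T_A`. [folklore] -/
theorem hcpB_eq_neg_image_hcpA (G : E3 →L[ℝ] E3) (ξ : E3) :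
    {v : E3 | ∃ b : Fin 3 → ℤ, v = latPt G hexFrame b ∨ v = latPt G hexFrame b - G (hcpShift + ξ)} =
      (fun w : E3 => -w) '' {v : E3 | ∃ b : Fin 3 → ℤ, v = latPt G hexFrame b ∨ v = latPt G hexFrame b + G (hcpShift + ξ)} := by
  ext v
  simp only [Set.mem_setOf_eq, Set.mem_image]
  constructor
  · rintro ⟨b, hb | hb⟩
    · exact ⟨-v, ⟨-b, Or.inl (by rw [latPt_neg, hb])⟩, neg_neg v⟩
    · exact ⟨-v, ⟨-b, Or.inr (by rw [latPt_neg, hb]; abel)⟩, neg_neg v⟩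
  · rintro ⟨w, ⟨b, hb | hb⟩, rfl⟩
    · exact ⟨-b, Or.inl (by rw [latPt_neg, hb])⟩
    · exact ⟨-b, Or.inr (by rw [latPt_neg, hb]; abel)⟩

/-- ★ **A/B symmetry of even set sums**: for a kernel with `g (−v) = g v`, the B-site set sum equals the A-site set sum. [folklore] -/
theorem finsum_hcpB_eq_hcpA (G : E3 →L[ℝ] E3) (ξ : E3) {g : E3 → ℝ} (hg : ∀ v : E3, g (-v) = g v) :
    ∑ᶠ v ∈ {v : E3 | ∃ b : Fin 3 → ℤ, v = latPt G hexFrame b ∨ v = latPt G hexFrame b - G (hcpShift + ξ)}, g v =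
      ∑ᶠ v ∈ {v : E3 | ∃ b : Fin 3 → ℤ, v = latPt G hexFrame b ∨ v = latPt G hexFrame b + G (hcpShift + ξ)}, g v := by
  rw [hcpB_eq_neg_image_hcpA, finsum_mem_image fun a _ b _ h => neg_injective h]
  exact finsum_mem_congr rfl fun v _ => hg v

/-- The same symmetry with the origin removed (the kernel `𝟙[v ≠ 0]·W ‖v‖` is even). [folklore] -/
theorem finsum_hcpB_eq_hcpA_ne_zero (G : E3 →L[ℝ] E3) (ξ : E3) (W : ℝ → ℝ) :
    ∑ᶠ v ∈ {v : E3 | v ≠ 0 ∧ v ∈ {v : E3 | ∃ b : Fin 3 → ℤ, v = latPt G hexFrame b ∨ v = latPt G hexFrame b - G (hcpShift + ξ)}}, W ‖v‖ =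
      ∑ᶠ v ∈ {v : E3 | v ≠ 0 ∧ ∃ b : Fin 3 → ℤ, v = latPt G hexFrame b ∨ v = latPt G hexFrame b + G (hcpShift + ξ)}, W ‖v‖ := by
  have key := finsum_hcpB_eq_hcpA G ξ (g := fun v : E3 => if v = 0 then 0 else W ‖v‖) fun v => by simp [norm_neg, neg_eq_zero]
  have hL : ∀ (S : Set E3), ∑ᶠ v ∈ S, (if v = 0 then 0 else W ‖v‖) = ∑ᶠ v ∈ {v : E3 | v ≠ 0 ∧ v ∈ S}, W ‖v‖ := by
    intro S
    rw [finsum_mem_def, finsum_mem_def]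
    congr 1
    funext v
    by_cases hv0 : v = 0
    · simp [Set.indicator, hv0]
    · by_cases hvS : v ∈ S <;> simp [Set.indicator, hv0, hvS]
  rw [hL, hL] at key
  simpa using key

/-! ## §4. The exact value of the piece's functional on admissible homogeneous balls -/

/-- ★★ **fcc**: on an admissible `133/10`-ball of `z c + G·L_fcc`,
`ballAvg (9/5) z (xRec M z) c = ½ ∑ᶠ_{v ∈ G·L_fcc, v ≠ 0} W₄₅ ‖v‖ − e_W` (EXACT; every member is interior: `9/5 + 9/2 ≤ 133/10`). [folklore] -/
theorem ballAvg_xRec_eq_latticeSum_fcc {M : ℕ} {z : Fin M → E3} {c : Fin M} {G : E3 →L[ℝ] E3} (hA : Admissible M z c)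
    (hrange : Set.range z = {x : E3 | dist x (z c) ≤ 133 / 10 ∧ ∃ a : Fin 3 → ℤ, x = z c + latPt G fccVec a}) :
    ballAvg (9 / 5) z (xRec M z) c =
      (∑ᶠ v ∈ {v : E3 | v ≠ 0 ∧ ∃ b : Fin 3 → ℤ, v = latPt G fccVec b}, effPot w₄₅ ω₄ (3 / 400) ‖v‖) / 2 - (-(7175 / 10000) + 3 / 400) := by
  have hz : Function.Injective z := hA.1
  have hW : ∀ r : ℝ, (9 : ℝ) / 2 ≤ r → effPot w₄₅ ω₄ (3 / 400) r = 0 := fun r hr => effPot_fourHalf_eq_zero _ hr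
  refine ballAvg_eq_of_const (by norm_num) (fun j hj => ?_) (fun j hj => ?_)
  · rw [xRec_eq_of_member hA hj, pairSum_sub_self_eq_finsum hz (locHom_fcc hrange hj) hW]
    rfl
  · rw [card_ball_eq_finsum hz (locHom_fcc hrange hj) (by norm_num : (9 : ℝ) / 5 < 9 / 2),
      card_ball_eq_finsum hz (locHom_fcc hrange (self_mem_ball (by norm_num) z c)) (by norm_num : (9 : ℝ) / 5 < 9 / 2)]

/-- ★★ **hcp**: on an admissible `133/10`-ball of `z c + (G·L_hex ∪ (G·L_hex + G(hcpShift + ξ)))`,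
`ballAvg (9/5) z (xRec M z) c = ½ ∑ᶠ_{v ∈ T_A, v ≠ 0} W₄₅ ‖v‖ − e_W`, `T_A = G·L_hex ∪ (G·L_hex + G(hcpShift + ξ))` (EXACT; B-sites contribute the
same value by the reflection `T_B = −T_A`). [folklore] -/
theorem ballAvg_xRec_eq_latticeSum_hcp {M : ℕ} {z : Fin M → E3} {c : Fin M} {G : E3 →L[ℝ] E3} {ξ : E3} (hA : Admissible M z c)
    (hrange : Set.range z = {x : E3 | dist x (z c) ≤ 133 / 10 ∧ ∃ a : Fin 3 → ℤ,
      x = z c + latPt G hexFrame a ∨ x = z c + latPt G hexFrame a + G (hcpShift + ξ)}) :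
    ballAvg (9 / 5) z (xRec M z) c =
      (∑ᶠ v ∈ {v : E3 | v ≠ 0 ∧ ∃ b : Fin 3 → ℤ, v = latPt G hexFrame b ∨ v = latPt G hexFrame b + G (hcpShift + ξ)},
        effPot w₄₅ ω₄ (3 / 400) ‖v‖) / 2 - (-(7175 / 10000) + 3 / 400) := by
  have hz : Function.Injective z := hA.1
  have hW : ∀ r : ℝ, (9 : ℝ) / 2 ≤ r → effPot w₄₅ ω₄ (3 / 400) r = 0 := fun r hr => effPot_fourHalf_eq_zero _ hr
  -- the value and the ball cardinality at any member, by the A/B case split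
  have hval : ∀ j ∈ ball (9 / 5) z c, xRec M z j =
      (∑ᶠ v ∈ {v : E3 | v ≠ 0 ∧ ∃ b : Fin 3 → ℤ, v = latPt G hexFrame b ∨ v = latPt G hexFrame b + G (hcpShift + ξ)},
        effPot w₄₅ ω₄ (3 / 400) ‖v‖) / 2 - (-(7175 / 10000) + 3 / 400) := by
    intro j hj
    have hjmem : z j ∈ Set.range z := ⟨j, rfl⟩
    rw [hrange] at hjmem
    obtain ⟨-, aj, haj | haj⟩ := hjmem
    · rw [xRec_eq_of_member hA hj, pairSum_sub_self_eq_finsum hz (locHom_hcpA hrange hj haj) hW]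
      rfl
    · rw [xRec_eq_of_member hA hj, pairSum_sub_self_eq_finsum hz (locHom_hcpB hrange hj haj) hW, finsum_hcpB_eq_hcpA_ne_zero]
  have hcardA : ∀ j ∈ ball (9 / 5) z c, ((ball (9 / 5) z j).card : ℝ) =
      ∑ᶠ v ∈ {v : E3 | ∃ b : Fin 3 → ℤ, v = latPt G hexFrame b ∨ v = latPt G hexFrame b + G (hcpShift + ξ)},
        (if ‖v‖ ≤ 9 / 5 then (1 : ℝ) else 0) := by
    intro j hj
    have hjmem : z j ∈ Set.range z := ⟨j, rfl⟩
    rw [hrange] at hjmem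
    obtain ⟨-, aj, haj | haj⟩ := hjmem
    · exact card_ball_eq_finsum hz (locHom_hcpA hrange hj haj) (by norm_num : (9 : ℝ) / 5 < 9 / 2)
    · rw [card_ball_eq_finsum hz (locHom_hcpB hrange hj haj) (by norm_num : (9 : ℝ) / 5 < 9 / 2)]
      exact finsum_hcpB_eq_hcpA G ξ fun v => by simp [norm_neg]
  refine ballAvg_eq_of_const (by norm_num) hval (fun j hj => ?_)
  rw [hcardA j hj, hcardA c (self_mem_ball (by norm_num) z c)]

/-! ## §5. The reduction of `HomFloor m` to the two lattice-sum inequalities -/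

/-- ★★★ **`HomFloor m` IS the pair of lattice-sum inequalities over the REALISED deformations** (exact reduction, CERT-DESIGN-g44 §0): for every
`G` with `‖G − 1‖ ≤ 1/4` realised by an admissible fcc ball, `m ≤ X_fcc(G)`, and for every `(G, ξ)` with `‖G − 1‖ ≤ 1/4`, `‖ξ‖ ≤ 1/4` realised by an
admissible hcp ball, `m ≤ X_hcp(G, ξ)`. [folklore] -/
theorem homFloor_iff_latticeSums {m : ℝ} :
    HomFloor m ↔
      (∀ G : E3 →L[ℝ] E3, ‖G - 1‖ ≤ 1 / 4 →
        (∃ (M : ℕ) (z : Fin M → E3) (c : Fin M), Admissible M z c ∧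
          Set.range z = {x : E3 | dist x (z c) ≤ 133 / 10 ∧ ∃ a : Fin 3 → ℤ, x = z c + latPt G fccVec a}) →
        m ≤ (∑ᶠ v ∈ {v : E3 | v ≠ 0 ∧ ∃ b : Fin 3 → ℤ, v = latPt G fccVec b}, effPot w₄₅ ω₄ (3 / 400) ‖v‖) / 2 - (-(7175 / 10000) + 3 / 400)) ∧
      (∀ (G : E3 →L[ℝ] E3) (ξ : E3), ‖G - 1‖ ≤ 1 / 4 → ‖ξ‖ ≤ 1 / 4 →
        (∃ (M : ℕ) (z : Fin M → E3) (c : Fin M), Admissible M z c ∧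
          Set.range z = {x : E3 | dist x (z c) ≤ 133 / 10 ∧ ∃ a : Fin 3 → ℤ,
            x = z c + latPt G hexFrame a ∨ x = z c + latPt G hexFrame a + G (hcpShift + ξ)}) →
        m ≤ (∑ᶠ v ∈ {v : E3 | v ≠ 0 ∧ ∃ b : Fin 3 → ℤ, v = latPt G hexFrame b ∨ v = latPt G hexFrame b + G (hcpShift + ξ)},
          effPot w₄₅ ω₄ (3 / 400) ‖v‖) / 2 - (-(7175 / 10000) + 3 / 400)) := by
  constructor
  · intro h
    refine ⟨fun G hG ⟨M, z, c, hA, hrange⟩ => ?_, fun G ξ hG hξ ⟨M, z, c, hA, hrange⟩ => ?_⟩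
    · rw [← ballAvg_xRec_eq_latticeSum_fcc hA hrange]
      exact h M z c hA ⟨G, 0, hG, by simp, Or.inl hrange⟩
    · rw [← ballAvg_xRec_eq_latticeSum_hcp hA hrange]
      exact h M z c hA ⟨G, ξ, hG, hξ, Or.inr hrange⟩
  · rintro ⟨hfcc, hhcp⟩ M z c hA ⟨G, ξ, hG, hξ, hrange | hrange⟩
    · rw [ballAvg_xRec_eq_latticeSum_fcc hA hrange]
      exact hfcc G hG ⟨M, z, c, hA, hrange⟩
    · rw [ballAvg_xRec_eq_latticeSum_hcp hA hrange]
      exact hhcp G ξ hG hξ ⟨M, z, c, hA, hrange⟩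

/-- ★★ **What a branch-and-bound certifies directly** (realisability-free sufficient form): if `m ≤ X_fcc(G)` for EVERY `‖G − 1‖ ≤ 1/4` and
`m ≤ X_hcp(G, ξ)` for EVERY `‖G − 1‖ ≤ 1/4`, `‖ξ‖ ≤ 1/4`, then `HomFloor m`.  (The certifier's prunes replace «every» by «every realised»: a deformation
whose ball has a `1/20`-good, `1/8`-bad or T-exempt member is realised by NO admissible cluster — use `homFloor_iff_latticeSums`.) [folklore] -/
theorem homFloor_of_latticeSums {m : ℝ}
    (hfcc : ∀ G : E3 →L[ℝ] E3, ‖G - 1‖ ≤ 1 / 4 →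
      m ≤ (∑ᶠ v ∈ {v : E3 | v ≠ 0 ∧ ∃ b : Fin 3 → ℤ, v = latPt G fccVec b}, effPot w₄₅ ω₄ (3 / 400) ‖v‖) / 2 - (-(7175 / 10000) + 3 / 400))
    (hhcp : ∀ (G : E3 →L[ℝ] E3) (ξ : E3), ‖G - 1‖ ≤ 1 / 4 → ‖ξ‖ ≤ 1 / 4 →
      m ≤ (∑ᶠ v ∈ {v : E3 | v ≠ 0 ∧ ∃ b : Fin 3 → ℤ, v = latPt G hexFrame b ∨ v = latPt G hexFrame b + G (hcpShift + ξ)},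
        effPot w₄₅ ω₄ (3 / 400) ‖v‖) / 2 - (-(7175 / 10000) + 3 / 400)) :
    HomFloor m :=
  homFloor_iff_latticeSums.2 ⟨fun G hG _ => hfcc G hG, fun G ξ hG hξ _ => hhcp G ξ hG hξ⟩

end Summit.AtomisticToContinuum.Crystallization.Theorems.FrustratedLawDichotomyStrainedPatchHomLattice

end
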